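import Mathlib.RingTheory.MvPolynomial.Basic
import Literature.NumberTheory.Transcendental.WeakCITGenericPoint
import HarnessLib

/-!
# Weak CIT, step 3b: a differential field in which the generic point is an exponential

Support file for the discharge of `Literature.NumberTheory.Transcendental.weakCIT`
(`IntersectionsWithTori.lean`). For a prime `P ⊆ ℂ[Y₁, …, Yₙ]` containing no variable (the
vanishing ideal of an irreducible closed subset `X` of the torus), with function field
`K = Frac(ℂ[Y]/P)` and generic point `ȳ ∈ (Kˣ)ⁿ` (`WeakCITGenericPoint.lean`), we build the field
`L = K(x₁, …, xₙ)` of rational functions in fresh indeterminates ("formal logarithms of the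
`ȳᵢ`") and derivations `D₁, …, Dₙ` of `L` over `ℂ` such that

* `Dⱼ ȳᵢ = ȳᵢ Dⱼ xᵢ` — `ȳ = exp x` for the exponential differential equation (Kirby 2009, §3:
  "`(x, y) ∈ Γ_S`", here for `S = 𝔾ₘⁿ`);
* `Dⱼ xᵢ = δᵢⱼ` for `i, j` in the index set `S ⊆ Fin n` of a transcendence basis of `K/ℂ` among the
  `ȳᵢ`, and `Dⱼ = 0` for `j ∉ S` — so the Jacobian `(Dⱼ xᵢ)` has rank `|S| = dim X`;
* a Laurent monomial `∏ ȳᵢ^{mᵢ}` killed by all `Dⱼ` is a complex number (the constants of the `Dⱼ`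
  inside `K` are exactly `ℂ`).

The `Dⱼ` are obtained from the dual derivations `∂ₐ` of `K/ℂ` (`basisDerivation`) by extending
to `L` (derivations extend along extensions of fields of characteristic zero,
`Derivation.exists_extension_of_charZero`) and correcting the values on the algebraically
independent `xᵢ` with the partial derivatives `∂/∂xᵢ` (`exists_derivation_of_algebraicIndependent`).
The output is packaged as a `LogPoint n` (the field `L` with `x, ȳ, D, S, P` and the properties
above), which is the per-factor input of the ultraproduct argument (`WeakCITUltraproduct.lean`,
`IntersectionsWithToriProofs.lean`). This is the step "let `y` be generic in `X` over `C`, take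
`x ∈ LS(F)` with `(x, y) ∈ Γ_S`; then `rk Jac(x, y) = rk Jac(y) = dim X`" of Kirby 2009, proof
of Thm 4.6.

## References

* J. Kirby, *The theory of the exponential differential equations of semiabelian varieties*,
  Selecta Math. 15 (2009) 445–486, §3 and proof of Thm 4.6.
-/

noncomputable section

open MvPolynomial Set

namespace Literature.NumberTheory.Transcendental.WeakCIT

variable {n : ℕ}

/-! ### The data produced for each irreducible `X`: a "logarithmic point" -/

/-- A **logarithmic point** in dimension `n`: a field `F ⊇ ℂ` of characteristic zero with
derivations `D₁, …, Dₙ` killing `ℂ`, a point `y ∈ (Fˣ)ⁿ` with "logarithms" `x ∈ Fⁿ`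
(`Dⱼ yᵢ = yᵢ Dⱼ xᵢ`), an index set `S` on which the Jacobian `(Dⱼ xᵢ)` is the identity, and a
prime `P ⊆ ℂ[Y]` of which `y` is a generic zero, of dimension `|S|`, such that a Laurent monomial
in `y` killed by all `Dⱼ` is a complex number. (Kirby 2009, proof of Thm 4.6: the tuple
`(x, y) ∈ Γ_S ∩ (Λ × X)` with `y` generic in `X`.) [cite: Kirby2009, Thm 4.6 (proof)] -/
structure LogPoint (n : ℕ) : Type 1 where
  /-- The differential field. -/
  F : Type
  [instField : Field F]
  [instCharZero : CharZero F]
  [instAlgebra : Algebra ℂ F]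
  /-- The logarithms. -/
  x : Fin n → F
  /-- The torus point (generic point of `Z(P)`). -/
  y : Fin n → F
  /-- The derivations (over `ℂ`, i.e. killing `ℂ`). -/
  D : Fin n → Derivation ℂ F F
  /-- Indices of a transcendence basis of `ℂ(y)/ℂ` among the `yᵢ`. -/
  S : Finset (Fin n)
  /-- The prime ideal of which `y` is a generic zero. -/
  P : Ideal (MvPolynomial (Fin n) ℂ)
  y_ne_zero : ∀ i, y i ≠ 0
  map_y : ∀ j i, D j (y i) = y i * D j (x i)
  map_x : ∀ i ∈ S, ∀ j, D j (x i) = if i = j then 1 else 0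
  aeval_eq_zero_iff : ∀ p : MvPolynomial (Fin n) ℂ, aeval y p = 0 ↔ p ∈ P
  exists_eq_algebraMap : ∀ m : Fin n → ℤ, (∀ j, D j (∏ i, y i ^ m i) = 0) →
    ∃ c : ℂ, ∏ i, y i ^ m i = algebraMap ℂ F c
  card_S : (((S.card : ℕ) : ℕ∞) : WithBot ℕ∞) = ringKrullDim (MvPolynomial (Fin n) ℂ ⧸ P)

attribute [instance] LogPoint.instField LogPoint.instCharZero LogPoint.instAlgebra

/-! ### The field `L = K(x₁, …, xₙ)` -/

section Construction

variable (P : Ideal (MvPolynomial (Fin n) ℂ)) [P.IsPrime]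

/-- The function field has characteristic zero. [folklore] -/
instance charZero_funcField : CharZero (FuncField P) :=
  charZero_of_injective_algebraMap (algebraMap ℂ (FuncField P)).injective

/-- The field `L = K(x₁, …, xₙ)` of rational functions over the function field `K` in `n` fresh
indeterminates (formal logarithms). [folklore] -/
abbrev LogField : Type := FractionRing (MvPolynomial (Fin n) (FuncField P))

/-- `L` has characteristic zero. [folklore] -/
instance charZero_logField : CharZero (LogField P) :=
  charZero_of_injective_algebraMap (algebraMap ℂ (LogField P)).injective

/-- The formal logarithms `xᵢ ∈ L`. [folklore] -/
def logX (i : Fin n) : LogField P :=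
  algebraMap (MvPolynomial (Fin n) (FuncField P)) (LogField P) (X i)

/-- The generic point viewed in `L`. [folklore] -/
def logY (i : Fin n) : LogField P := algebraMap (FuncField P) (LogField P) (genPt P i)

omit [P.IsPrime] in
/-- The `xᵢ` are algebraically independent over `K`. [folklore] -/
theorem algebraicIndependent_logX : AlgebraicIndependent (FuncField P) (logX P) := by
  have h := (algebraicIndependent_X (Fin n) (FuncField P)).map'
    (f := IsScalarTower.toAlgHom (FuncField P) (MvPolynomial (Fin n) (FuncField P)) (LogField P))
    (IsFractionRing.injective (MvPolynomial (Fin n) (FuncField P)) (LogField P))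
  exact h

/-- The generic point has non-zero coordinates in `L` when no variable lies in `P`. [folklore] -/
theorem logY_ne_zero {i : Fin n} (hi : (X i : MvPolynomial (Fin n) ℂ) ∉ P) : logY P i ≠ 0 := by
  rw [logY, map_ne_zero_iff _ (algebraMap (FuncField P) (LogField P)).injective]
  exact genPt_ne_zero P hi

/-- The partial derivatives `∂/∂xᵢ` of `L/K`: `K`-derivations `Eᵢ` with `Eᵢ xₗ = δᵢₗ`.
[cite: Rosenlicht1976, Prop. 3] -/
theorem exists_coordDerivation (i : Fin n) :
    ∃ E : Derivation (FuncField P) (LogField P) (LogField P),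
      ∀ l, E (logX P l) = if l = i then 1 else 0 := by
  classical
  exact exists_derivation_of_algebraicIndependent (k := FuncField P) (K := LogField P)
    (algebraicIndependent_logX P) _

/-- **Extension with prescribed values on the logarithms**: a `ℂ`-derivation `δ` of `K` extends to
a `ℂ`-derivation of `L = K(x)` taking arbitrary prescribed values `wₗ` at the `xₗ` (extend `δ`
anyhow, then correct by `Σₗ (wₗ - ·) ∂/∂xₗ`). [cite: Rosenlicht1976, Prop. 3] -/
theorem exists_extension (δ : Derivation ℂ (FuncField P) (FuncField P)) (w : Fin n → LogField P) :
    ∃ Dδ : Derivation ℂ (LogField P) (LogField P),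
      (∀ z, Dδ (algebraMap (FuncField P) (LogField P) z) = algebraMap _ _ (δ z)) ∧
      ∀ l, Dδ (logX P l) = w l := by
  classical
  obtain ⟨d₀, hd₀⟩ := Derivation.exists_extension_of_charZero (R := ℂ) (F := FuncField P)
    (T := LogField P) (M := LogField P) ((Algebra.linearMap (FuncField P) (LogField P)).compDer δ)
  choose E hE using exists_coordDerivation P
  refine ⟨d₀ + ∑ i, (w i - d₀ (logX P i)) • (E i).restrictScalars ℂ, fun z => ?_, fun l => ?_⟩
  · rw [Derivation.add_apply, hd₀]
    have : (∑ i, (w i - d₀ (logX P i)) • (E i).restrictScalars ℂ)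
        (algebraMap (FuncField P) (LogField P) z) = 0 := by
      have h := congrFun (map_sum Derivation.coeFnAddMonoidHom
        (fun i => (w i - d₀ (logX P i)) • (E i).restrictScalars ℂ) Finset.univ)
        (algebraMap (FuncField P) (LogField P) z)
      rw [Derivation.coeFnAddMonoidHom_apply, Finset.sum_apply] at h
      rw [h]
      refine Finset.sum_eq_zero fun i _ => ?_
      rw [Derivation.coeFnAddMonoidHom_apply, Derivation.coe_smul, Pi.smul_apply,
        Derivation.restrictScalars_apply, Derivation.map_algebraMap, smul_zero]
    rw [this, add_zero]
    rfl
  · rw [Derivation.add_apply]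
    have : (∑ i, (w i - d₀ (logX P i)) • (E i).restrictScalars ℂ) (logX P l) = w l - d₀ (logX P l) := by
      have h := congrFun (map_sum Derivation.coeFnAddMonoidHom
        (fun i => (w i - d₀ (logX P i)) • (E i).restrictScalars ℂ) Finset.univ) (logX P l)
      rw [Derivation.coeFnAddMonoidHom_apply, Finset.sum_apply] at h
      rw [h]
      have h2 : ∀ i, (Derivation.coeFnAddMonoidHom ((w i - d₀ (logX P i)) • (E i).restrictScalars ℂ))
          (logX P l) = if l = i then w i - d₀ (logX P i) else 0 := fun i => by
        rw [Derivation.coeFnAddMonoidHom_apply, Derivation.coe_smul, Pi.smul_apply,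
          Derivation.restrictScalars_apply, hE i l, smul_eq_mul]
        split_ifs <;> simp
      simp only [h2, Finset.sum_ite_eq, Finset.mem_univ, if_true]
    rw [this, add_sub_cancel]

/-- The extension of the dual derivation `∂ₐ` of `K` to `L`, normalised by
`D xₗ = ∂ₐ(ȳₗ) / ȳₗ` ("`ȳ = exp x`"). [folklore] -/
def extDerivation (a : basisSet P) : Derivation ℂ (LogField P) (LogField P) :=
  (exists_extension P (basisDerivation P a)
    (fun l => algebraMap (FuncField P) (LogField P) (basisDerivation P a (genPt P l)) * (logY P l)⁻¹)).choose

/-- `extDerivation a` extends `∂ₐ`. [folklore] -/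
theorem extDerivation_algebraMap (a : basisSet P) (z : FuncField P) :
    extDerivation P a (algebraMap (FuncField P) (LogField P) z) =
      algebraMap (FuncField P) (LogField P) (basisDerivation P a z) :=
  (exists_extension P (basisDerivation P a) _).choose_spec.1 z

/-- The values of `extDerivation a` on the logarithms. [folklore] -/
theorem extDerivation_logX (a : basisSet P) (l : Fin n) :
    extDerivation P a (logX P l) =
      algebraMap (FuncField P) (LogField P) (basisDerivation P a (genPt P l)) * (logY P l)⁻¹ :=
  (exists_extension P (basisDerivation P a) _).choose_spec.2 l

/-- The derivations `D₁, …, Dₙ` of `L`: `Dⱼ` extends `∂_{Ȳⱼ}` for `j` a basis index, and `Dⱼ = 0`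
otherwise. [folklore] -/
def logDerivation (j : Fin n) : Derivation ℂ (LogField P) (LogField P) := by
  classical
  exact if h : j ∈ basisIdx P then extDerivation P ⟨coordFn P j, coordFn_mem_basisSet P h⟩ else 0

/-- `Dⱼ` for a basis index `j`. [folklore] -/
theorem logDerivation_of_mem {j : Fin n} (h : j ∈ basisIdx P) :
    logDerivation P j = extDerivation P ⟨coordFn P j, coordFn_mem_basisSet P h⟩ := by
  classical
  simp [logDerivation, h]

/-- `Dⱼ = 0` for a non-basis index `j`. [folklore] -/
theorem logDerivation_of_not_mem {j : Fin n} (h : j ∉ basisIdx P) : logDerivation P j = 0 := by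
  classical
  simp [logDerivation, h]

/-- On `K`, `Dⱼ` is `∂_{Ȳⱼ}` (basis index) or `0`. [folklore] -/
theorem logDerivation_algebraMap_funcField {j : Fin n} (h : j ∈ basisIdx P) (z : FuncField P) :
    logDerivation P j (algebraMap (FuncField P) (LogField P) z) =
      algebraMap (FuncField P) (LogField P)
        (basisDerivation P ⟨coordFn P j, coordFn_mem_basisSet P h⟩ z) := by
  rw [logDerivation_of_mem P h, extDerivation_algebraMap]

/-- **The exponential differential equation** `Dⱼ ȳᵢ = ȳᵢ Dⱼ xᵢ`. [cite: Kirby2009, §3] -/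
theorem logDerivation_logY (hP : ∀ i, (X i : MvPolynomial (Fin n) ℂ) ∉ P) (j i : Fin n) :
    logDerivation P j (logY P i) = logY P i * logDerivation P j (logX P i) := by
  by_cases h : j ∈ basisIdx P
  · rw [logY, logDerivation_algebraMap_funcField P h, logDerivation_of_mem P h,
      extDerivation_logX, ← logY,
      mul_comm (algebraMap _ _ _) (logY P i)⁻¹, ← mul_assoc, mul_inv_cancel₀ (logY_ne_zero P (hP i)),
      one_mul]
  · rw [logDerivation_of_not_mem P h, Derivation.zero_apply, Derivation.zero_apply, mul_zero]

/-- **The Jacobian is the identity on the basis indices**: `Dⱼ xᵢ = δᵢⱼ` for `i ∈ S`.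
[cite: Kirby2009, Thm 4.6 (proof)] -/
theorem logDerivation_logX (hP : ∀ i, (X i : MvPolynomial (Fin n) ℂ) ∉ P) {i : Fin n}
    (hi : i ∈ basisIdx P) (j : Fin n) :
    logDerivation P j (logX P i) = if i = j then 1 else 0 := by
  classical
  by_cases h : j ∈ basisIdx P
  · rw [logDerivation_of_mem P h, extDerivation_logX]
    have hb : genPt P i = algebraMap (CoordRing P) (FuncField P)
        ((⟨coordFn P i, coordFn_mem_basisSet P hi⟩ : basisSet P) : CoordRing P) := rfl
    rw [hb, basisDerivation_apply_basis]
    by_cases hij : i = j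
    · subst hij
      simp only [if_true]
      rw [← hb, ← logY, mul_inv_cancel₀ (logY_ne_zero P (hP i))]
    · have hne : (⟨coordFn P j, coordFn_mem_basisSet P h⟩ : basisSet P) ≠
          ⟨coordFn P i, coordFn_mem_basisSet P hi⟩ := fun heq =>
        hij (coordFn_injOn P hi h (Subtype.mk.inj heq).symm)
      rw [if_neg hne, if_neg hij, map_zero, zero_mul]
  · have hij : i ≠ j := fun heq => h (heq ▸ hi)
    rw [logDerivation_of_not_mem P h, Derivation.zero_apply, if_neg hij]

/-- **Genericity in `L`**: a polynomial over `ℂ` vanishes at `ȳ ∈ Lⁿ` iff it lies in `P`.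
[cite: Marker2006, §1] -/
theorem aeval_logY_eq_zero_iff (p : MvPolynomial (Fin n) ℂ) : aeval (logY P) p = 0 ↔ p ∈ P := by
  have h : (aeval (logY P) : MvPolynomial (Fin n) ℂ →ₐ[ℂ] LogField P) =
      (IsScalarTower.toAlgHom ℂ (FuncField P) (LogField P)).comp (aeval (genPt P)) :=
    MvPolynomial.algHom_ext fun i => by simp [logY]
  rw [h, AlgHom.comp_apply, IsScalarTower.coe_toAlgHom',
    map_eq_zero_iff (algebraMap (FuncField P) (LogField P))
      (algebraMap (FuncField P) (LogField P)).injective,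
    aeval_genPt_eq_zero_iff]

/-- **Constant Laurent monomials are complex numbers**: if `∏ ȳᵢ^{mᵢ}` is killed by all `Dⱼ`, it
is (the image of) a complex number. [cite: Kirby2009, Thm 4.6 (proof)] -/
theorem exists_eq_algebraMap_of_forall (m : Fin n → ℤ)
    (hm : ∀ j, logDerivation P j (∏ i, logY P i ^ m i) = 0) :
    ∃ c : ℂ, ∏ i, logY P i ^ m i = algebraMap ℂ (LogField P) c := by
  set z : FuncField P := ∏ i, genPt P i ^ m i with hz
  have hyz : ∏ i, logY P i ^ m i = algebraMap (FuncField P) (LogField P) z := by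
    simp only [hz, map_prod, map_zpow₀, logY]
  have hza : ∀ a : basisSet P, basisDerivation P a z = 0 := by
    intro a
    have hj : idx P a ∈ basisIdx P := (mem_basisIdx_iff P).mpr ⟨a, rfl⟩
    have ha : (⟨coordFn P (idx P a), coordFn_mem_basisSet P hj⟩ : basisSet P) = a :=
      Subtype.ext (coordFn_idx P a)
    have h := hm (idx P a)
    rw [hyz, logDerivation_algebraMap_funcField P hj, ha,
      map_eq_zero_iff _ (algebraMap (FuncField P) (LogField P)).injective] at h
    exact h
  obtain ⟨c, hc⟩ := mem_range_of_forall_basisDerivation_eq_zero P hza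
  refine ⟨c, ?_⟩
  rw [hyz, ← hc, ← IsScalarTower.algebraMap_apply]

/-- **Existence of logarithmic points**: every prime `P ⊆ ℂ[Y]` containing no variable is the
ideal of a logarithmic point, with `S` the chosen basis indices. [cite: Kirby2009, Thm 4.6 (proof)] -/
theorem exists_logPoint (hP : ∀ i, (X i : MvPolynomial (Fin n) ℂ) ∉ P) :
    ∃ L : LogPoint n, L.P = P ∧ L.S = basisIdx P :=
  ⟨{ F := LogField P
     x := logX P
     y := logY P
     D := logDerivation P
     S := basisIdx P
     P := P
     y_ne_zero := fun i => logY_ne_zero P (hP i)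
     map_y := logDerivation_logY P hP
     map_x := fun _ hi j => logDerivation_logX P hP hi j
     aeval_eq_zero_iff := aeval_logY_eq_zero_iff P
     exists_eq_algebraMap := exists_eq_algebraMap_of_forall P
     card_S := card_basisIdx P }, rfl, rfl⟩

end Construction

/-- **Logarithmic points of irreducible subvarieties of the torus**: for `X ⊆ (ℂˣ)ⁿ` irreducible
closed there is a logarithmic point with ideal `I(X)`; in particular `dim X = |S|`.
[cite: Kirby2009, Thm 4.6 (proof)] -/
theorem exists_logPoint_of_isIrreducibleInTorus {X : Set (Fin n → ℂ)} (hX : IsIrreducibleInTorus ℂ n X) :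
    ∃ L : LogPoint n, L.P = vanishingIdeal ℂ X ∧
      (((L.S.card : ℕ) : ℕ∞) : WithBot ℕ∞) = zariskiDim ℂ X := by
  haveI := isPrime_vanishingIdeal hX
  obtain ⟨hXU, hne⟩ := IsIrreducibleInTorus.subset_unitLocus hX
  obtain ⟨L, hLP, -⟩ := exists_logPoint (vanishingIdeal ℂ X) (X_notMem_vanishingIdeal hXU hne)
  refine ⟨L, hLP, ?_⟩
  rw [L.card_S, hLP]
  rfl

end Literature.NumberTheory.Transcendental.WeakCIT
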